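import Mathlib
import Literature.NumberTheory.LFunctions.Zhang2022.SmoothWeightDiagonal
import HarnessLib

/-!
# Zhang (2022) §15 p. 81 (`Z22:§15.u012`): diagonal extraction after "integrating term by term", for a LONG Dirichlet polynomial

Topic `Literature/NumberTheory/LFunctions/Zhang2022` (Landau–Siegel audit tree; verdict-neutral; ZHANG-L discharge
lane, helper under the v19 leaf `Typed.Section15A.Eq15_6` via `Z22:§15.u012`). Y. Zhang, *Discrete mean estimates
and the Landau–Siegel zero*, arXiv:2211.02515v1 (2022) [Zhang2022LandauSiegel] — **an unrefereed manuscript under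
adjudication**; this file proves an elementary inequality and asserts nothing about the manuscript's claims.

Companion of `Zhang2022/SmoothWeightDiagonal.lean`. After `SmoothWeight.integral_LSeries_mul_sum_mul_omega`
one is left with `Σ_m Σ_{n∈S} T(m,n)X(m,n)`, `T(m,n) = a(m)m^{−s₀}·b(n)n^{s₀−1}·e^{−𝓛₂² log²(n/m)}`, where for the
character sum `X(m,n) = Σ*_{ψ (mod p)} ψ(n)ψ̄(m)` one has `|X| ≤ 1` off the diagonal below `p` and `|X| ≤ p − 1`
always. `SmoothWeight.norm_offDiagonal_le` bounds the off-diagonal part by `(Σ_m|a(m)|m^{−3/2})(Σ_{n∈S}|b(n)|√n)·…`,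
which is sharp enough when `S ⊆ [1, D⁴]` (§17) but NOT for the polynomial `B(s,ψ)` of (15.4), whose length is `PT⁻²`
(the factor `Σ|b(n)|√n ≍ (PT⁻²)^{3/2}` exceeds the target `PD^{−4/5}`). Here the near terms `m < p` are bounded
WITHOUT the Gaussian (`e^{−𝓛₂²log²} ≤ 1`), keeping the symmetric weights `m^{−1/2}n^{−1/2}` and a FINITE `m`-sum,
and only the far terms `m ≥ p` use the Gaussian (`SmoothWeight.rpow_mul_rpow_mul_exp_le_far`):

* `SmoothWeight.summable_sum_term_mul` — absolute convergence of the `m`-series for any bounded weights `X`;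
* `SmoothWeight.norm_tsum_sum_term_mul_le_three` — for `S ⊆ [1,N]`, `N < p`, `𝓛₂² log(p/N) ≥ 1`, `|X(m,n)| ≤ 1`
  (`m ≠ n`, `m < p`), `|X(m,n)| ≤ X₂` (all `m, n`):
  `‖Σ_mΣ_{n∈S}T(m,n)X(m,n)‖ ≤ (Σ_{m<p}|a(m)|m^{−1/2})(Σ_{n∈S}|b(n)|n^{−1/2}) + X₂Σ_{n∈S}|a(n)b(n)|/n
   + X₂(Σ_m|a(m)|m^{−3/2})(Σ_{n∈S}|b(n)|√n)e^{−u₀(𝓛₂²u₀−1)}`, `u₀ = log(p/N)`;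
* `SmoothWeight.norm_tsum_offDiagonal_le_near_far` (rev 2) — the same bound for the OFF-DIAGONAL part alone
  (`n ≠ m`; hypotheses identical to `SmoothWeight.norm_offDiagonal_le`, for which it is a drop-in strengthening
  when the polynomial is long: (17.3)/(17.8), where the diagonal is the main term).

## References

* Y. Zhang, arXiv:2211.02515v1 (2022), §15 p. 81 (proof of (15.4), "it follows that … ≪ PD^{−4/5}"); §17 p. 96.
  [cite: Zhang2022LandauSiegel, §15 p. 81]
-/

noncomputable section

open Complex Real

namespace Literature.NumberTheory.LFunctions.Zhang2022

namespace SmoothWeight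

/-- `|a(m)|m^{−3/2} = ‖term a (3/2) m‖` for `m ≥ 1`. [folklore] -/
private theorem norm_term_three_halves' (a : ℕ → ℂ) {m : ℕ} (hm : m ≠ 0) :
    ‖LSeries.term a (3 / 2 : ℂ) m‖ = ‖a m‖ * (m : ℝ) ^ (-(3 / 2 : ℝ)) := by
  have hm' : (0 : ℝ) < m := Nat.cast_pos.mpr (Nat.pos_of_ne_zero hm)
  rw [LSeries.norm_term_eq, if_neg hm, Real.rpow_neg hm'.le, div_eq_mul_inv]
  norm_num

/-- `m^{−1/2}·m^{−1/2} = m⁻¹` for `m ≥ 1`. [folklore] -/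
private theorem rpow_neg_half_mul_self {m : ℕ} (hm : m ≠ 0) :
    (m : ℝ) ^ (-(1 / 2 : ℝ)) * (m : ℝ) ^ (-(1 / 2 : ℝ)) = (m : ℝ)⁻¹ := by
  have hm' : (0 : ℝ) < m := Nat.cast_pos.mpr (Nat.pos_of_ne_zero hm)
  rw [← Real.rpow_add hm', show (-(1 / 2 : ℝ)) + -(1 / 2 : ℝ) = -1 by norm_num, Real.rpow_neg_one]

/-- **Summability of the `m`-series after integrating term by term, for bounded weights**: with
`T(m,n) = a(m)m^{−s₀}b(n)n^{s₀−1}e^{−𝓛₂² log²(n/m)}`, `S ∌ 0` finite, `|X(m,n)| ≤ X_b` on `S`, and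
`Σ|a(m)|m^{−3/2} < ∞`, the series `Σ_m Σ_{n∈S} T(m,n)X(m,n)` converges absolutely (each term is
`≤ |a(m)|m^{−3/2}·|b(n)|√n·e^{1/(4𝓛₂²)}·X_b`, `SmoothWeight.rpow_mul_rpow_mul_exp_le`).
[cite: Zhang2022LandauSiegel, §15 p. 81 (proof of (15.4))] -/
theorem summable_sum_term_mul {L₂ : ℝ} (hL : 0 < L₂) (t₀ : ℝ) {a : ℕ → ℂ}
    (ha : LSeriesSummable a (3 / 2 : ℂ)) (b : ℕ → ℂ) {S : Finset ℕ} (hS : 0 ∉ S)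
    (X : ℕ → ℕ → ℂ) {Xb : ℝ} (hXb : ∀ m n, n ∈ S → ‖X m n‖ ≤ Xb) :
    Summable (fun m : ℕ => ∑ n ∈ S, LSeries.term a (s0 t₀) m * (b n * (n : ℂ) ^ (s0 t₀ - 1)) *
          cexp (-(L₂ : ℂ) ^ 2 * (Real.log ((n : ℝ) / m) : ℂ) ^ 2) * X m n) := by
  have hXb0 : ∀ n ∈ S, 0 ≤ Xb := fun n hn => (norm_nonneg _).trans (hXb 0 n hn)
  set B : ℝ := ∑ n ∈ S, ‖b n‖ * (n : ℝ) ^ (1 / 2 : ℝ) with hB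
  set E : ℝ := Real.exp (1 / (4 * L₂ ^ 2)) with hE
  have hmaj : Summable fun m : ℕ => ‖LSeries.term a (3 / 2 : ℂ) m‖ * (B * E * |Xb|) :=
    (summable_norm_iff.mpr ha).mul_right _
  refine Summable.of_norm_bounded hmaj fun m => ?_
  rcases eq_or_ne m 0 with rfl | hm
  · simp [LSeries.term_zero]
  calc ‖∑ n ∈ S, LSeries.term a (s0 t₀) m * (b n * (n : ℂ) ^ (s0 t₀ - 1)) *
          cexp (-(L₂ : ℂ) ^ 2 * (Real.log ((n : ℝ) / m) : ℂ) ^ 2) * X m n‖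
      ≤ ∑ n ∈ S, ‖LSeries.term a (s0 t₀) m * (b n * (n : ℂ) ^ (s0 t₀ - 1)) *
          cexp (-(L₂ : ℂ) ^ 2 * (Real.log ((n : ℝ) / m) : ℂ) ^ 2) * X m n‖ := norm_sum_le _ _
    _ ≤ ∑ n ∈ S, ‖a m‖ * (m : ℝ) ^ (-(3 / 2 : ℝ)) * (‖b n‖ * (n : ℝ) ^ (1 / 2 : ℝ)) * E * |Xb| := by
        refine Finset.sum_le_sum fun n hn => ?_
        have hn0 : n ≠ 0 := fun h => hS (h ▸ hn)
        rw [norm_mul, norm_term_mul_eq t₀ a b hm hn0]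
        have h1 := rpow_mul_rpow_mul_exp_le hL hm hn0
        have hX : ‖X m n‖ ≤ |Xb| := (hXb m n hn).trans (le_abs_self _)
        have h0 : 0 ≤ ‖a m‖ * ‖b n‖ := mul_nonneg (norm_nonneg _) (norm_nonneg _)
        calc ‖a m‖ * (m : ℝ) ^ (-(1 / 2 : ℝ)) * (‖b n‖ * (n : ℝ) ^ (-(1 / 2 : ℝ))) *
              Real.exp (-(L₂ ^ 2 * Real.log ((n : ℝ) / m) ^ 2)) * ‖X m n‖
            = ‖a m‖ * ‖b n‖ * ((m : ℝ) ^ (-(1 / 2 : ℝ)) * (n : ℝ) ^ (-(1 / 2 : ℝ)) *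
                Real.exp (-(L₂ ^ 2 * Real.log ((n : ℝ) / m) ^ 2))) * ‖X m n‖ := by ring
          _ ≤ ‖a m‖ * ‖b n‖ * ((m : ℝ) ^ (-(3 / 2 : ℝ)) * (n : ℝ) ^ (1 / 2 : ℝ) * E) * |Xb| := by
              gcongr
          _ = ‖a m‖ * (m : ℝ) ^ (-(3 / 2 : ℝ)) * (‖b n‖ * (n : ℝ) ^ (1 / 2 : ℝ)) * E * |Xb| := by
              ring
    _ = ‖LSeries.term a (3 / 2 : ℂ) m‖ * (B * E * |Xb|) := by
        rw [norm_term_three_halves' a hm, hB, Finset.sum_mul, Finset.sum_mul, Finset.mul_sum]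
        refine Finset.sum_congr rfl fun n _ => ?_
        ring

/-- **Diagonal extraction with a wide polynomial** (the "trivial bound" of `Z22:§15.u012`, p. 81,
made explicit; companion of `SmoothWeight.norm_offDiagonal_le`, whose off-diagonal bound puts all
the decay on `m` and is too lossy when the polynomial `Σ_{n∈S} b(n)n^{s−1}` is as long as `PT⁻²`).
With `T(m,n) = a(m)m^{−s₀}b(n)n^{s₀−1}e^{−𝓛₂² log²(n/m)}` (the terms produced by
`SmoothWeight.integral_LSeries_mul_sum_mul_omega`), `S ⊆ [1,N]`, `N < p`, `𝓛₂² log(p/N) ≥ 1`,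
and weights with `|X(m,n)| ≤ 1` for `m ≠ n`, `m < p` (OFF the diagonal, NEAR) and `|X(m,n)| ≤ X₂`
always (for the character sum `Σ*_{ψ (mod p)} ψ(n)ψ̄(m)`: `X₂ = p − 1`):
`‖Σ_m Σ_{n∈S} T(m,n)X(m,n)‖ ≤ (Σ_{m<p}|a(m)|m^{−1/2})(Σ_{n∈S}|b(n)|n^{−1/2})` (near terms, Gaussian
dropped) `+ X₂ Σ_{n∈S}|a(n)b(n)|/n` (diagonal) `+ X₂ (Σ_m|a(m)|m^{−3/2})(Σ_{n∈S}|b(n)|√n)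
e^{−u₀(𝓛₂²u₀−1)}` (far terms `m ≥ p`, `u₀ = log(p/N)`, `SmoothWeight.rpow_mul_rpow_mul_exp_le_far`),
together with the summability of the `m`-series. [cite: Zhang2022LandauSiegel, §15 p. 81 (proof of (15.4))] -/
theorem norm_tsum_sum_term_mul_le_three {L₂ : ℝ} (hL : 0 < L₂) (t₀ : ℝ) {a : ℕ → ℂ}
    (ha : LSeriesSummable a (3 / 2 : ℂ)) (b : ℕ → ℂ) {S : Finset ℕ} {N p : ℕ}
    (hS : ∀ n ∈ S, n ≠ 0 ∧ n ≤ N) (hNp : N < p)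
    (hu₀ : 1 ≤ L₂ ^ 2 * Real.log ((p : ℝ) / N)) (X : ℕ → ℕ → ℂ) {X₂ : ℝ} (hX₂ : 0 ≤ X₂)
    (hX1 : ∀ m n, n ∈ S → m ≠ n → m < p → ‖X m n‖ ≤ 1)
    (hX2 : ∀ m n, n ∈ S → ‖X m n‖ ≤ X₂) :
    Summable (fun m : ℕ => ∑ n ∈ S, LSeries.term a (s0 t₀) m * (b n * (n : ℂ) ^ (s0 t₀ - 1)) *
          cexp (-(L₂ : ℂ) ^ 2 * (Real.log ((n : ℝ) / m) : ℂ) ^ 2) * X m n) ∧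
    ‖∑' m : ℕ, ∑ n ∈ S, LSeries.term a (s0 t₀) m * (b n * (n : ℂ) ^ (s0 t₀ - 1)) *
          cexp (-(L₂ : ℂ) ^ 2 * (Real.log ((n : ℝ) / m) : ℂ) ^ 2) * X m n‖
      ≤ (∑ m ∈ Finset.range p, ‖a m‖ * (m : ℝ) ^ (-(1 / 2 : ℝ))) *
            (∑ n ∈ S, ‖b n‖ * (n : ℝ) ^ (-(1 / 2 : ℝ)))
        + X₂ * ∑ n ∈ S, ‖a n‖ * ‖b n‖ / n
        + X₂ * ((∑' m : ℕ, ‖LSeries.term a (3 / 2 : ℂ) m‖) *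
            (∑ n ∈ S, ‖b n‖ * (n : ℝ) ^ (1 / 2 : ℝ)) *
            Real.exp (-(Real.log ((p : ℝ) / N) * (L₂ ^ 2 * Real.log ((p : ℝ) / N) - 1)))) := by
  classical
  have hS0 : 0 ∉ S := fun h => (hS 0 h).1 rfl
  set T : ℕ → ℕ → ℂ := fun m n => LSeries.term a (s0 t₀) m * (b n * (n : ℂ) ^ (s0 t₀ - 1)) *
    cexp (-(L₂ : ℂ) ^ 2 * (Real.log ((n : ℝ) / m) : ℂ) ^ 2) with hT
  set B₁ : ℝ := ∑ n ∈ S, ‖b n‖ * (n : ℝ) ^ (-(1 / 2 : ℝ)) with hB₁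
  set B₃ : ℝ := ∑ n ∈ S, ‖b n‖ * (n : ℝ) ^ (1 / 2 : ℝ) with hB₃
  set E : ℝ := Real.exp (-(Real.log ((p : ℝ) / N) * (L₂ ^ 2 * Real.log ((p : ℝ) / N) - 1)))
    with hE
  have hB₁0 : 0 ≤ B₁ := Finset.sum_nonneg fun n _ => by positivity
  have hB₃0 : 0 ≤ B₃ := Finset.sum_nonneg fun n _ => by positivity
  have hE0 : 0 ≤ E := (Real.exp_pos _).le
  -- the three majorants
  set G₁ : ℕ → ℝ := fun m => if m < p then ‖a m‖ * (m : ℝ) ^ (-(1 / 2 : ℝ)) * B₁ else 0 with hG₁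
  set G₂ : ℕ → ℝ := fun m => if m ∈ S then X₂ * (‖a m‖ * ‖b m‖ / m) else 0 with hG₂
  set G₃ : ℕ → ℝ := fun m => X₂ * (‖LSeries.term a (3 / 2 : ℂ) m‖ * B₃ * E) with hG₃
  have hG₁0 : ∀ m, 0 ≤ G₁ m := fun m => by
    simp only [hG₁]; split_ifs <;> positivity
  have hG₂0 : ∀ m, 0 ≤ G₂ m := fun m => by
    simp only [hG₂]; split_ifs <;> positivity
  have hG₃0 : ∀ m, 0 ≤ G₃ m := fun m => by simp only [hG₃]; positivity
  -- termwise domination `‖Σ_n T(m,n)X(m,n)‖ ≤ G₁ m + G₂ m + G₃ m`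
  have hle : ∀ m : ℕ, ‖∑ n ∈ S, T m n * X m n‖ ≤ G₁ m + G₂ m + G₃ m := by
    intro m
    rcases eq_or_ne m 0 with rfl | hm
    · have h0 : ∀ n, T 0 n = 0 := fun n => by simp [hT, LSeries.term_zero]
      simp only [h0, zero_mul, Finset.sum_const_zero, norm_zero]
      exact add_nonneg (add_nonneg (hG₁0 0) (hG₂0 0)) (hG₃0 0)
    have hm' : (0 : ℝ) < m := Nat.cast_pos.mpr (Nat.pos_of_ne_zero hm)
    refine (norm_sum_le _ _).trans ?_
    by_cases hmp : m < p
    · -- near: split off the diagonal term `n = m`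
      rw [← Finset.sum_filter_add_sum_filter_not S (fun n => n = m)]
      have hdiag : ∑ n ∈ S.filter (fun n => n = m), ‖T m n * X m n‖ ≤ G₂ m := by
        rw [Finset.filter_eq' S m]
        simp only [hG₂]
        split_ifs with hmS
        · rw [Finset.sum_singleton, norm_mul, hT, norm_term_mul_eq t₀ a b hm hm,
            div_self hm'.ne', Real.log_one]
          simp only [ne_eq, OfNat.ofNat_ne_zero, not_false_eq_true, zero_pow, mul_zero, neg_zero,
            Real.exp_zero, mul_one]
          have hX := hX2 m m hmS
          calc ‖a m‖ * (m : ℝ) ^ (-(1 / 2 : ℝ)) * (‖b m‖ * (m : ℝ) ^ (-(1 / 2 : ℝ))) * ‖X m m‖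
              = ‖a m‖ * ‖b m‖ * ((m : ℝ) ^ (-(1 / 2 : ℝ)) * (m : ℝ) ^ (-(1 / 2 : ℝ))) * ‖X m m‖ := by
                ring
            _ = ‖a m‖ * ‖b m‖ / m * ‖X m m‖ := by rw [rpow_neg_half_mul_self hm, div_eq_mul_inv]
            _ ≤ ‖a m‖ * ‖b m‖ / m * X₂ :=
                mul_le_mul_of_nonneg_left hX (by positivity)
            _ = X₂ * (‖a m‖ * ‖b m‖ / m) := by ring
        · rw [Finset.sum_empty]
      have hoff : ∑ n ∈ S.filter (fun n => ¬n = m), ‖T m n * X m n‖ ≤ G₁ m := by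
        simp only [hG₁, if_pos hmp]
        calc ∑ n ∈ S.filter (fun n => ¬n = m), ‖T m n * X m n‖
            ≤ ∑ n ∈ S.filter (fun n => ¬n = m), ‖a m‖ * (m : ℝ) ^ (-(1 / 2 : ℝ)) *
                (‖b n‖ * (n : ℝ) ^ (-(1 / 2 : ℝ))) := by
              refine Finset.sum_le_sum fun n hn => ?_
              obtain ⟨hnS, hnm⟩ := Finset.mem_filter.mp hn
              have hn0 : n ≠ 0 := (hS n hnS).1
              rw [norm_mul, hT, norm_term_mul_eq t₀ a b hm hn0]
              have hX := hX1 m n hnS (Ne.symm hnm) hmp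
              have hexp : Real.exp (-(L₂ ^ 2 * Real.log ((n : ℝ) / m) ^ 2)) ≤ 1 :=
                Real.exp_le_one_iff.mpr (neg_nonpos.mpr (by positivity))
              have h0 : 0 ≤ ‖a m‖ * (m : ℝ) ^ (-(1 / 2 : ℝ)) * (‖b n‖ * (n : ℝ) ^ (-(1 / 2 : ℝ))) := by
                positivity
              calc ‖a m‖ * (m : ℝ) ^ (-(1 / 2 : ℝ)) * (‖b n‖ * (n : ℝ) ^ (-(1 / 2 : ℝ))) *
                    Real.exp (-(L₂ ^ 2 * Real.log ((n : ℝ) / m) ^ 2)) * ‖X m n‖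
                  ≤ ‖a m‖ * (m : ℝ) ^ (-(1 / 2 : ℝ)) * (‖b n‖ * (n : ℝ) ^ (-(1 / 2 : ℝ))) * 1 * 1 := by
                    gcongr
                _ = _ := by ring
          _ ≤ ∑ n ∈ S, ‖a m‖ * (m : ℝ) ^ (-(1 / 2 : ℝ)) * (‖b n‖ * (n : ℝ) ^ (-(1 / 2 : ℝ))) :=
              Finset.sum_le_sum_of_subset_of_nonneg (Finset.filter_subset _ _)
                (fun n _ _ => by positivity)
          _ = ‖a m‖ * (m : ℝ) ^ (-(1 / 2 : ℝ)) * B₁ := by rw [hB₁, Finset.mul_sum]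
      linarith [hdiag, hoff, hG₃0 m]
    · -- far: `m ≥ p > N ≥ n`, Gaussian decay
      have hpm : p ≤ m := not_lt.mp hmp
      have hfar : ∑ n ∈ S, ‖T m n * X m n‖ ≤ G₃ m := by
        simp only [hG₃]
        calc ∑ n ∈ S, ‖T m n * X m n‖
            ≤ ∑ n ∈ S, X₂ * (‖a m‖ * (m : ℝ) ^ (-(3 / 2 : ℝ)) * (‖b n‖ * (n : ℝ) ^ (1 / 2 : ℝ)) * E) := by
              refine Finset.sum_le_sum fun n hnS => ?_
              obtain ⟨hn0, hnN⟩ := hS n hnS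
              rw [norm_mul, hT, norm_term_mul_eq t₀ a b hm hn0]
              have h1 := rpow_mul_rpow_mul_exp_le_far (L₂ := L₂) hn0 hnN hNp hpm hu₀
              have hX := hX2 m n hnS
              have h0 : 0 ≤ ‖a m‖ * ‖b n‖ := mul_nonneg (norm_nonneg _) (norm_nonneg _)
              calc ‖a m‖ * (m : ℝ) ^ (-(1 / 2 : ℝ)) * (‖b n‖ * (n : ℝ) ^ (-(1 / 2 : ℝ))) *
                    Real.exp (-(L₂ ^ 2 * Real.log ((n : ℝ) / m) ^ 2)) * ‖X m n‖
                  = ‖a m‖ * ‖b n‖ * ((m : ℝ) ^ (-(1 / 2 : ℝ)) * (n : ℝ) ^ (-(1 / 2 : ℝ)) *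
                      Real.exp (-(L₂ ^ 2 * Real.log ((n : ℝ) / m) ^ 2))) * ‖X m n‖ := by ring
                _ ≤ ‖a m‖ * ‖b n‖ * ((m : ℝ) ^ (-(3 / 2 : ℝ)) * (n : ℝ) ^ (1 / 2 : ℝ) * E) * X₂ := by
                    gcongr
                _ = X₂ * (‖a m‖ * (m : ℝ) ^ (-(3 / 2 : ℝ)) * (‖b n‖ * (n : ℝ) ^ (1 / 2 : ℝ)) * E) := by
                    ring
          _ = X₂ * (‖LSeries.term a (3 / 2 : ℂ) m‖ * B₃ * E) := by
              rw [norm_term_three_halves' a hm, hB₃]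
              simp only [Finset.mul_sum, Finset.sum_mul]
      linarith [hfar, hG₁0 m, hG₂0 m]
  -- summability of the majorant
  have hG₁s : Summable G₁ := by
    refine summable_of_ne_finset_zero (s := Finset.range p) fun m hm => ?_
    simp only [hG₁, if_neg (fun h => hm (Finset.mem_range.mpr h))]
  have hG₂s : Summable G₂ := by
    refine summable_of_ne_finset_zero (s := S) fun m hm => ?_
    simp only [hG₂, if_neg hm]
  have hG₃s : Summable G₃ := (((summable_norm_iff.mpr ha).mul_right _).mul_right _).mul_left _
  have hGs : Summable fun m => G₁ m + G₂ m + G₃ m := (hG₁s.add hG₂s).add hG₃s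
  have hFs : Summable (fun m : ℕ => ∑ n ∈ S, T m n * X m n) := Summable.of_norm_bounded hGs hle
  refine ⟨hFs, ?_⟩
  -- evaluate the three majorant series
  have hG₁t : ∑' m, G₁ m = (∑ m ∈ Finset.range p, ‖a m‖ * (m : ℝ) ^ (-(1 / 2 : ℝ))) * B₁ := by
    rw [tsum_eq_sum (s := Finset.range p) (fun m hm => by
      simp only [hG₁, if_neg (fun h => hm (Finset.mem_range.mpr h))]), Finset.sum_mul]
    refine Finset.sum_congr rfl fun m hm => ?_
    simp only [hG₁, if_pos (Finset.mem_range.mp hm)]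
  have hG₂t : ∑' m, G₂ m = X₂ * ∑ n ∈ S, ‖a n‖ * ‖b n‖ / n := by
    rw [tsum_eq_sum (s := S) (fun m hm => by simp only [hG₂, if_neg hm]), Finset.mul_sum]
    refine Finset.sum_congr rfl fun m hm => ?_
    simp only [hG₂, if_pos hm]
  have hG₃t : ∑' m, G₃ m = X₂ * ((∑' m : ℕ, ‖LSeries.term a (3 / 2 : ℂ) m‖) * B₃ * E) := by
    simp only [hG₃]
    rw [tsum_mul_left, tsum_mul_right, tsum_mul_right]
  calc ‖∑' m : ℕ, ∑ n ∈ S, T m n * X m n‖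
      ≤ ∑' m, (G₁ m + G₂ m + G₃ m) := tsum_of_norm_bounded hGs.hasSum hle
    _ = ∑' m, G₁ m + ∑' m, G₂ m + ∑' m, G₃ m := by
        rw [(hG₁s.add hG₂s).tsum_add hG₃s, hG₁s.tsum_add hG₂s]
    _ = _ := by rw [hG₁t, hG₂t, hG₃t]

/-- **The off-diagonal part alone, near/far** — the drop-in strengthening of
`SmoothWeight.norm_offDiagonal_le` for LONG polynomials (same hypotheses, same left side; used where the
diagonal `n = m` is the MAIN term, as in (17.3)/(17.8), rather than an error as in (15.4)):
`‖Σ_m Σ_{n∈S, n≠m} T(m,n)X(m,n)‖ ≤ (Σ_{m<p}|a(m)|m^{−1/2})(Σ_{n∈S}|b(n)|n^{−1/2})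
 + X₂(Σ_m|a(m)|m^{−3/2})(Σ_{n∈S}|b(n)|√n)e^{−u₀(𝓛₂²u₀−1)}` (`u₀ = log(p/N)`), with the summability of the
off-diagonal `m`-series. [cite: Zhang2022LandauSiegel, §17 p. 96 ("By trivial estimation"); §15 p. 81] -/
theorem norm_tsum_offDiagonal_le_near_far {L₂ : ℝ} (hL : 0 < L₂) (t₀ : ℝ) {a : ℕ → ℂ}
    (ha : LSeriesSummable a (3 / 2 : ℂ)) (b : ℕ → ℂ) {S : Finset ℕ} {N p : ℕ}
    (hS : ∀ n ∈ S, n ≠ 0 ∧ n ≤ N) (hNp : N < p)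
    (hu₀ : 1 ≤ L₂ ^ 2 * Real.log ((p : ℝ) / N)) (X : ℕ → ℕ → ℂ) {X₂ : ℝ} (hX₂ : 0 ≤ X₂)
    (hX1 : ∀ m n, n ∈ S → m ≠ n → m < p → ‖X m n‖ ≤ 1)
    (hX2 : ∀ m n, n ∈ S → p ≤ m → ‖X m n‖ ≤ X₂) :
    Summable (fun m : ℕ => ∑ n ∈ S.filter (fun n => n ≠ m),
        LSeries.term a (s0 t₀) m * (b n * (n : ℂ) ^ (s0 t₀ - 1)) *
          cexp (-(L₂ : ℂ) ^ 2 * (Real.log ((n : ℝ) / m) : ℂ) ^ 2) * X m n) ∧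
    ‖∑' m : ℕ, ∑ n ∈ S.filter (fun n => n ≠ m),
        LSeries.term a (s0 t₀) m * (b n * (n : ℂ) ^ (s0 t₀ - 1)) *
          cexp (-(L₂ : ℂ) ^ 2 * (Real.log ((n : ℝ) / m) : ℂ) ^ 2) * X m n‖
      ≤ (∑ m ∈ Finset.range p, ‖a m‖ * (m : ℝ) ^ (-(1 / 2 : ℝ))) *
            (∑ n ∈ S, ‖b n‖ * (n : ℝ) ^ (-(1 / 2 : ℝ)))
        + X₂ * ((∑' m : ℕ, ‖LSeries.term a (3 / 2 : ℂ) m‖) *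
            (∑ n ∈ S, ‖b n‖ * (n : ℝ) ^ (1 / 2 : ℝ)) *
            Real.exp (-(Real.log ((p : ℝ) / N) * (L₂ ^ 2 * Real.log ((p : ℝ) / N) - 1)))) := by
  classical
  set T : ℕ → ℕ → ℂ := fun m n => LSeries.term a (s0 t₀) m * (b n * (n : ℂ) ^ (s0 t₀ - 1)) *
    cexp (-(L₂ : ℂ) ^ 2 * (Real.log ((n : ℝ) / m) : ℂ) ^ 2) with hT
  set B₁ : ℝ := ∑ n ∈ S, ‖b n‖ * (n : ℝ) ^ (-(1 / 2 : ℝ)) with hB₁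
  set B₃ : ℝ := ∑ n ∈ S, ‖b n‖ * (n : ℝ) ^ (1 / 2 : ℝ) with hB₃
  set E : ℝ := Real.exp (-(Real.log ((p : ℝ) / N) * (L₂ ^ 2 * Real.log ((p : ℝ) / N) - 1)))
    with hE
  have hB₁0 : 0 ≤ B₁ := Finset.sum_nonneg fun n _ => by positivity
  have hB₃0 : 0 ≤ B₃ := Finset.sum_nonneg fun n _ => by positivity
  have hE0 : 0 ≤ E := (Real.exp_pos _).le
  set G₁ : ℕ → ℝ := fun m => if m < p then ‖a m‖ * (m : ℝ) ^ (-(1 / 2 : ℝ)) * B₁ else 0 with hG₁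
  set G₃ : ℕ → ℝ := fun m => X₂ * (‖LSeries.term a (3 / 2 : ℂ) m‖ * B₃ * E) with hG₃
  have hG₁0 : ∀ m, 0 ≤ G₁ m := fun m => by
    simp only [hG₁]; split_ifs <;> positivity
  have hG₃0 : ∀ m, 0 ≤ G₃ m := fun m => by simp only [hG₃]; positivity
  -- termwise domination of the off-diagonal sums
  have hle : ∀ m : ℕ, ‖∑ n ∈ S.filter (fun n => n ≠ m), T m n * X m n‖ ≤ G₁ m + G₃ m := by
    intro m
    rcases eq_or_ne m 0 with rfl | hm
    · have h0 : ∀ n, T 0 n = 0 := fun n => by simp [hT, LSeries.term_zero]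
      simp only [h0, zero_mul, Finset.sum_const_zero, norm_zero]
      exact add_nonneg (hG₁0 0) (hG₃0 0)
    have hm' : (0 : ℝ) < m := Nat.cast_pos.mpr (Nat.pos_of_ne_zero hm)
    refine (norm_sum_le _ _).trans ?_
    by_cases hmp : m < p
    · have hoff : ∑ n ∈ S.filter (fun n => n ≠ m), ‖T m n * X m n‖ ≤ G₁ m := by
        simp only [hG₁, if_pos hmp]
        calc ∑ n ∈ S.filter (fun n => n ≠ m), ‖T m n * X m n‖
            ≤ ∑ n ∈ S.filter (fun n => n ≠ m), ‖a m‖ * (m : ℝ) ^ (-(1 / 2 : ℝ)) *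
                (‖b n‖ * (n : ℝ) ^ (-(1 / 2 : ℝ))) := by
              refine Finset.sum_le_sum fun n hn => ?_
              obtain ⟨hnS, hnm⟩ := Finset.mem_filter.mp hn
              have hn0 : n ≠ 0 := (hS n hnS).1
              rw [norm_mul, hT, norm_term_mul_eq t₀ a b hm hn0]
              have hX := hX1 m n hnS (Ne.symm hnm) hmp
              have hexp : Real.exp (-(L₂ ^ 2 * Real.log ((n : ℝ) / m) ^ 2)) ≤ 1 :=
                Real.exp_le_one_iff.mpr (neg_nonpos.mpr (by positivity))
              have h0 : 0 ≤ ‖a m‖ * (m : ℝ) ^ (-(1 / 2 : ℝ)) * (‖b n‖ * (n : ℝ) ^ (-(1 / 2 : ℝ))) := by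
                positivity
              calc ‖a m‖ * (m : ℝ) ^ (-(1 / 2 : ℝ)) * (‖b n‖ * (n : ℝ) ^ (-(1 / 2 : ℝ))) *
                    Real.exp (-(L₂ ^ 2 * Real.log ((n : ℝ) / m) ^ 2)) * ‖X m n‖
                  ≤ ‖a m‖ * (m : ℝ) ^ (-(1 / 2 : ℝ)) * (‖b n‖ * (n : ℝ) ^ (-(1 / 2 : ℝ))) * 1 * 1 := by
                    gcongr
                _ = _ := by ring
          _ ≤ ∑ n ∈ S, ‖a m‖ * (m : ℝ) ^ (-(1 / 2 : ℝ)) * (‖b n‖ * (n : ℝ) ^ (-(1 / 2 : ℝ))) :=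
              Finset.sum_le_sum_of_subset_of_nonneg (Finset.filter_subset _ _)
                (fun n _ _ => by positivity)
          _ = ‖a m‖ * (m : ℝ) ^ (-(1 / 2 : ℝ)) * B₁ := by rw [hB₁, Finset.mul_sum]
      linarith [hoff, hG₃0 m]
    · have hpm : p ≤ m := not_lt.mp hmp
      have hfar : ∑ n ∈ S.filter (fun n => n ≠ m), ‖T m n * X m n‖ ≤ G₃ m := by
        simp only [hG₃]
        calc ∑ n ∈ S.filter (fun n => n ≠ m), ‖T m n * X m n‖
            ≤ ∑ n ∈ S, ‖T m n * X m n‖ :=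
              Finset.sum_le_sum_of_subset_of_nonneg (Finset.filter_subset _ _)
                (fun n _ _ => norm_nonneg _)
          _ ≤ ∑ n ∈ S, X₂ * (‖a m‖ * (m : ℝ) ^ (-(3 / 2 : ℝ)) * (‖b n‖ * (n : ℝ) ^ (1 / 2 : ℝ)) * E) := by
              refine Finset.sum_le_sum fun n hnS => ?_
              obtain ⟨hn0, hnN⟩ := hS n hnS
              rw [norm_mul, hT, norm_term_mul_eq t₀ a b hm hn0]
              have h1 := rpow_mul_rpow_mul_exp_le_far (L₂ := L₂) hn0 hnN hNp hpm hu₀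
              have hX := hX2 m n hnS hpm
              have h0 : 0 ≤ ‖a m‖ * ‖b n‖ := mul_nonneg (norm_nonneg _) (norm_nonneg _)
              calc ‖a m‖ * (m : ℝ) ^ (-(1 / 2 : ℝ)) * (‖b n‖ * (n : ℝ) ^ (-(1 / 2 : ℝ))) *
                    Real.exp (-(L₂ ^ 2 * Real.log ((n : ℝ) / m) ^ 2)) * ‖X m n‖
                  = ‖a m‖ * ‖b n‖ * ((m : ℝ) ^ (-(1 / 2 : ℝ)) * (n : ℝ) ^ (-(1 / 2 : ℝ)) *
                      Real.exp (-(L₂ ^ 2 * Real.log ((n : ℝ) / m) ^ 2))) * ‖X m n‖ := by ring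
                _ ≤ ‖a m‖ * ‖b n‖ * ((m : ℝ) ^ (-(3 / 2 : ℝ)) * (n : ℝ) ^ (1 / 2 : ℝ) * E) * X₂ := by
                    gcongr
                _ = X₂ * (‖a m‖ * (m : ℝ) ^ (-(3 / 2 : ℝ)) * (‖b n‖ * (n : ℝ) ^ (1 / 2 : ℝ)) * E) := by
                    ring
          _ = X₂ * (‖LSeries.term a (3 / 2 : ℂ) m‖ * B₃ * E) := by
              rw [norm_term_three_halves' a hm, hB₃]
              simp only [Finset.mul_sum, Finset.sum_mul]
      linarith [hfar, hG₁0 m]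
  have hG₁s : Summable G₁ := by
    refine summable_of_ne_finset_zero (s := Finset.range p) fun m hm => ?_
    simp only [hG₁, if_neg (fun h => hm (Finset.mem_range.mpr h))]
  have hG₃s : Summable G₃ := (((summable_norm_iff.mpr ha).mul_right _).mul_right _).mul_left _
  have hGs : Summable fun m => G₁ m + G₃ m := hG₁s.add hG₃s
  have hFs : Summable (fun m : ℕ => ∑ n ∈ S.filter (fun n => n ≠ m), T m n * X m n) :=
    Summable.of_norm_bounded hGs hle
  refine ⟨hFs, ?_⟩
  have hG₁t : ∑' m, G₁ m = (∑ m ∈ Finset.range p, ‖a m‖ * (m : ℝ) ^ (-(1 / 2 : ℝ))) * B₁ := by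
    rw [tsum_eq_sum (s := Finset.range p) (fun m hm => by
      simp only [hG₁, if_neg (fun h => hm (Finset.mem_range.mpr h))]), Finset.sum_mul]
    refine Finset.sum_congr rfl fun m hm => ?_
    simp only [hG₁, if_pos (Finset.mem_range.mp hm)]
  have hG₃t : ∑' m, G₃ m = X₂ * ((∑' m : ℕ, ‖LSeries.term a (3 / 2 : ℂ) m‖) * B₃ * E) := by
    simp only [hG₃]
    rw [tsum_mul_left, tsum_mul_right, tsum_mul_right]
  calc ‖∑' m : ℕ, ∑ n ∈ S.filter (fun n => n ≠ m), T m n * X m n‖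
      ≤ ∑' m, (G₁ m + G₃ m) := tsum_of_norm_bounded hGs.hasSum hle
    _ = ∑' m, G₁ m + ∑' m, G₃ m := hG₁s.tsum_add hG₃s
    _ = _ := by rw [hG₁t, hG₃t]

end SmoothWeight

end Literature.NumberTheory.LFunctions.Zhang2022
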